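import Mathlib
import Summits.Ventures.HodgeRepro2.Tier7.Target

/-!
# Tier 7 — LINE 1 (HECKE-MODULE RIGIDITY): definitions and sorry-free bridges (`Line1/Defs.lean`; the `U(W)` interface is `Line1/TwoTorus.lean`)

Sorry-free companion of the HOME skeleton `route/t7/Line1/Skeleton.lean` (t7-plan-1): every `def` the line's provers
mention and every bridge the line has PROVED, so that prover products can import them by name (lead l. 14635 (3)).
Nothing here is the step: the one open statement of the line — `prodModS D ⊓ prodModSbar D ≠ ⊥` for the real
datum, equivalently (`commonIrred_iff_inf_ne_bot`) «`P_A` and `P_B` share a Hecke-irreducible constituent» — is NOT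
declared here; the HOME skeleton carries it as the sorried `inf_ne_bot`, and the deliverable `p_T7_of_residual :
R_CommonIrred → P_T7` below is sorry-free. Imports: `Mathlib` + `Summits.Ventures.HodgeRepro2.Tier7.Target` only.

Contents. §1 the Hecke modules `P_A := ⟨fOmegaS g⟩`, `P_B := ⟨fOmegaSbar g⟩` generated by the wedges, their
stability; §2 bilinearity of `L2`; §3 (P) from `P_A ⊓ P_B ≠ ⊥` (`hr_pos` + `H20_multone`-free: a pure-tensor
argument); §4 `CommonIrred` and the kernel-proved equivalences `CommonIrred ↔ P_A ⊓ P_B ≠ ⊥` ((H9) one way, (H10)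
the other) and `CommonIrred → (P)`; §6 the `U(W)` interface `TwoTorusData` (seesaw descent, Kudla 1984) with
`TwoTorus ↔ CommonIrred` on the tautological data; §7 `TransportData` (transport by `g ∈ GU(W)(F)` of similitude
factor `u`, TIER5 N0.3 (D1); Tunnell–Saito sign compatibility `swapOK` on the swap set `S = S_g ∪ {ι_2}`), the
local-global form `TwoTorusLocal ↔ TwoTorus`, the obstruction shape `not_two_torus_of_no_swapOK`; §5 the closed
residual `R_CommonIrred`, the sorry-free deliverable `p_T7_of_residual`, `R_TwoTorus ↔ R_CommonIrred` (a theorem —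
the `U(W)` clothing adds no axiom, crit-1 l. 14626 O2(a)), and `not_commonIrred_of_mul_eq_bot` (the residual fails
in the square-zero datum of record). Honest status of the residual (lead l. 14635, crit-1 O2): `R_CommonIrred ≡
«∀ D, P_A ⊓ P_B ≠ ⊥»` is ≡ C(D) under finite dimension (t7-L1-p5) and OPEN otherwise; it is the target's
«P_A ⊓ P_B ≠ ⊥» form, not a strictly weaker statement. «uses an L-value-free non-vanishing device: yes» applies to
the reduction (a)–(e) of LEMMAS.md §2, not to the existence (f).
-/

namespace Summit.Ventures.HodgeRepro2.Tier7.Line1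

open Summit.Ventures.HodgeRepro2.Tier7

section
variable {K : Type} [Field K] [NumberField K] {E' : Type} [Field E'] [NumberField E']
  {V : Type} [AddCommGroup V] [Module E' V] {HX : Type} [Ring HX] [Algebra ℂ HX]
  {G : Type} [Group G] [MulAction G HX] (D : PeriodDatum K E' V HX G)


/-! ## 1. The two Hecke modules generated by the wedges -/

/-- `P_A`: the ℂ-span of the wedges `θ(μ_0) ∧ θ(μ_1)` over all Hecke translates. -/
def prodModS : Submodule ℂ HX := Submodule.span ℂ (Set.range D.fOmegaS)

/-- `P_B`: the ℂ-span of the wedges `θ(μ_2) ∧ θ(μ_3)` over all Hecke translates. -/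
def prodModSbar : Submodule ℂ HX := Submodule.span ℂ (Set.range D.fOmegaSbar)

/-- a translated theta lift is a holomorphic 1-form -/
theorem theta_mem_H10 (g : Fin 4 → G) (i : Fin 4) : D.theta g i ∈ D.S.H10 :=
  D.S.act_H10 (g i) _ (D.omega_le i (D.theta_mem i))

/-- (PROVED) the first wedge lies in `H10 * H10` -/
theorem fOmegaS_mem_mul (g : Fin 4 → G) : D.fOmegaS g ∈ D.S.H10 * D.S.H10 :=
  Submodule.mul_mem_mul (theta_mem_H10 D g 0) (theta_mem_H10 D g 1)

/-- (PROVED) the second wedge lies in `H10 * H10` -/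
theorem fOmegaSbar_mem_mul (g : Fin 4 → G) : D.fOmegaSbar g ∈ D.S.H10 * D.S.H10 :=
  Submodule.mul_mem_mul (theta_mem_H10 D g 2) (theta_mem_H10 D g 3)

/-- `P_A ⊆ H^{1,0} ∧ H^{1,0}` -/
theorem prodModS_le : prodModS D ≤ D.S.H10 * D.S.H10 :=
  Submodule.span_le.mpr (by rintro _ ⟨g, rfl⟩; exact fOmegaS_mem_mul D g)

/-- `P_B ⊆ H^{1,0} ∧ H^{1,0}` -/
theorem prodModSbar_le : prodModSbar D ≤ D.S.H10 * D.S.H10 :=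
  Submodule.span_le.mpr (by rintro _ ⟨g, rfl⟩; exact fOmegaSbar_mem_mul D g)

/-- (PROVED) the Hecke action fixes `0` (`act_add` with `a = b = 0`) -/
theorem act_zero (S : SurfaceShadow HX G) (h : G) : h • (0 : HX) = 0 := by
  have h0 := S.act_add h 0 0
  rw [add_zero] at h0
  exact add_left_cancel (h0.symm.trans (add_zero _).symm)

/-- (PROVED) the action translates the corner vectors: `h • theta g i = theta (h * g ·) i` -/
theorem theta_smul (h : G) (g : Fin 4 → G) (i : Fin 4) :
    h • D.theta g i = D.theta (fun j => h * g j) i := by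
  simp [PeriodDatum.theta, mul_smul]

/-- a Hecke translate permutes the wedges: `h • (θ_0 ∧ θ_1)(g) = (θ_0 ∧ θ_1)(h g)` -/
theorem fOmegaS_smul (h : G) (g : Fin 4 → G) : h • D.fOmegaS g = D.fOmegaS (fun j => h * g j) := by
  unfold PeriodDatum.fOmegaS
  rw [D.S.act_mul, theta_smul, theta_smul]

/-- (PROVED) the action translates the second wedge (from `act_mul`) -/
theorem fOmegaSbar_smul (h : G) (g : Fin 4 → G) :
    h • D.fOmegaSbar g = D.fOmegaSbar (fun j => h * g j) := by
  unfold PeriodDatum.fOmegaSbar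
  rw [D.S.act_mul, theta_smul, theta_smul]

/-- `P_A` is Hecke-stable (H3) -/
theorem prodModS_stable : HeckeStable G (prodModS D) := by
  intro h a ha
  induction ha using Submodule.span_induction with
  | mem x hx =>
    obtain ⟨g, rfl⟩ := hx
    rw [fOmegaS_smul]
    exact Submodule.subset_span ⟨_, rfl⟩
  | zero => rw [act_zero D.S]; exact Submodule.zero_mem _
  | add x y _ _ hx hy => rw [D.S.act_add]; exact Submodule.add_mem _ hx hy
  | smul c x _ hx => rw [D.S.act_smul]; exact Submodule.smul_mem _ c hx

/-- `P_B` is Hecke-stable (H3) -/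
theorem prodModSbar_stable : HeckeStable G (prodModSbar D) := by
  intro h a ha
  induction ha using Submodule.span_induction with
  | mem x hx =>
    obtain ⟨g, rfl⟩ := hx
    rw [fOmegaSbar_smul]
    exact Submodule.subset_span ⟨_, rfl⟩
  | zero => rw [act_zero D.S]; exact Submodule.zero_mem _
  | add x y _ _ hx hy => rw [D.S.act_add]; exact Submodule.add_mem _ hx hy
  | smul c x _ hx => rw [D.S.act_smul]; exact Submodule.smul_mem _ c hx

/-! ## 2. Bilinearity of the L² pairing (from (H4)) -/

section L2
variable (S : SurfaceShadow HX G)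

/-- (PROVED) `bar 0 = 0` (from `bar_add`) -/
theorem bar_zero : S.bar (0 : HX) = 0 := by
  have h0 := S.bar_add 0 0
  rw [add_zero] at h0
  exact add_left_cancel (h0.symm.trans (add_zero _).symm)

/-- (PROVED) `L2` is additive on the left (from `intX_add`, `mul_add`-free: `add_mul`) -/
theorem L2_add_left (a b c : HX) : S.L2 (a + b) c = S.L2 a c + S.L2 b c := by
  simp [SurfaceShadow.L2, add_mul, map_add]

/-- (PROVED) `L2` is `ℂ`-linear on the left (from `intX_smul`) -/
theorem L2_smul_left (z : ℂ) (a c : HX) : S.L2 (z • a) c = z * S.L2 a c := by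
  simp [SurfaceShadow.L2, Algebra.smul_mul_assoc, map_smul]

/-- (PROVED) `L2 0 c = 0` -/
theorem L2_zero_left (c : HX) : S.L2 0 c = 0 := by
  simp [SurfaceShadow.L2]

/-- (PROVED) `L2` is additive on the right (from `bar_add`, `intX_add`) -/
theorem L2_add_right (a b c : HX) : S.L2 a (b + c) = S.L2 a b + S.L2 a c := by
  simp [SurfaceShadow.L2, S.bar_add, mul_add, map_add]

/-- (PROVED) `L2` is conjugate-linear on the right (from `bar_smul`, `intX_smul`) -/
theorem L2_smul_right (z : ℂ) (a b : HX) : S.L2 a (z • b) = (starRingEnd ℂ) z * S.L2 a b := by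
  simp [SurfaceShadow.L2, S.bar_smul, Algebra.mul_smul_comm, map_smul]

/-- (PROVED) `L2 a 0 = 0` -/
theorem L2_zero_right (a : HX) : S.L2 a 0 = 0 := by
  simp [SurfaceShadow.L2, bar_zero]

end L2

/-! ## 3. The proved reduction: a common non-zero vector of `P_A` and `P_B` forces a non-zero pure pairing -/

/-- the pairing of a wedge from `P_A`'s generators with one from `P_B`'s only sees `g 0, g 1` resp. `g 2, g 3`:
if every same-`g` pairing vanishes, every mixed pairing vanishes -/
theorem pure_pairing_of_diag (hcon : ∀ g : Fin 4 → G, D.S.L2 (D.fOmegaS g) (D.fOmegaSbar g) = 0)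
    (g g' : Fin 4 → G) : D.S.L2 (D.fOmegaS g) (D.fOmegaSbar g') = 0 := by
  have h := hcon (fun i => if (i : ℕ) < 2 then g i else g' i)
  simpa [PeriodDatum.fOmegaS, PeriodDatum.fOmegaSbar, PeriodDatum.theta] using h

/-- **(P) from a common vector** (no sorry): if `P_A ⊓ P_B ≠ ⊥` then some choice of translates has
`⟨f^*Ω_s, f^*Ω_{s̄}⟩_{L²} ≠ 0`. Uses (H4) `hr_pos` and the bilinearity of `L2`. -/
theorem exists_pairing_ne_zero_of_inf_ne_bot (h : prodModS D ⊓ prodModSbar D ≠ ⊥) :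
    ∃ g : Fin 4 → G, D.S.L2 (D.fOmegaS g) (D.fOmegaSbar g) ≠ 0 := by
  by_contra hcon
  have hcon' : ∀ g : Fin 4 → G, D.S.L2 (D.fOmegaS g) (D.fOmegaSbar g) = 0 := fun g => by
    by_contra hne
    exact hcon ⟨g, hne⟩
  have hA : ∀ a ∈ prodModS D, ∀ g' : Fin 4 → G, D.S.L2 a (D.fOmegaSbar g') = 0 := by
    intro a ha g'
    induction ha using Submodule.span_induction with
    | mem x hx =>
      obtain ⟨g, rfl⟩ := hx
      exact pure_pairing_of_diag D hcon' g g'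
    | zero => exact L2_zero_left _ _
    | add x y _ _ hx hy => rw [L2_add_left, hx, hy, add_zero]
    | smul z x _ hx => rw [L2_smul_left, hx, mul_zero]
  have hAB : ∀ a ∈ prodModS D, ∀ b ∈ prodModSbar D, D.S.L2 a b = 0 := by
    intro a ha b hb
    induction hb using Submodule.span_induction with
    | mem x hx =>
      obtain ⟨g', rfl⟩ := hx
      exact hA a ha g'
    | zero => exact L2_zero_right _ _
    | add x y _ _ hx hy => rw [L2_add_right, hx, hy, add_zero]
    | smul z x _ hx => rw [L2_smul_right, hx, mul_zero]
  obtain ⟨γ, hγ, hγne⟩ := (Submodule.ne_bot_iff _).mp h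
  have hpos := D.S.hr_pos γ (prodModS_le D hγ.1) hγne
  have h0 : D.S.intX (γ * D.S.bar γ) = 0 := hAB γ hγ.1 γ hγ.2
  rw [h0] at hpos
  simp at hpos


/-! ## 4. The crux and its surroundings: `CommonIrred ↔ P_A ⊓ P_B ≠ ⊥` (kernel-proved both ways) -/

/-- (PROVED) the inf of two Hecke-stable submodules is Hecke-stable -/
theorem heckeStable_inf {U U' : Submodule ℂ HX} (hU : HeckeStable G U) (hU' : HeckeStable G U') :
    HeckeStable G (U ⊓ U') :=
  fun g a ha => ⟨hU g a ha.1, hU' g a ha.2⟩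

/-- (PROVED, from (H9)) a non-zero Hecke-stable subspace of `H^{2,0}` contains a Hecke-irreducible one -/
theorem exists_irred_le_of_stable {U : Submodule ℂ HX} (hle : U ≤ D.S.H10 * D.S.H10)
    (hs : HeckeStable G U) (hne : U ≠ ⊥) : ∃ W : Submodule ℂ HX, W ≤ U ∧ HeckeIrred G W :=
  (D.S.H20_semisimple U hle hs).2 hne

/-- (PROVED, from (H9)) `P_A ≠ ⊥ → P_A` contains a Hecke-irreducible constituent -/
theorem exists_irred_le_prodModS (h : prodModS D ≠ ⊥) :
    ∃ W : Submodule ℂ HX, W ≤ prodModS D ∧ HeckeIrred G W :=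
  exists_irred_le_of_stable D (prodModS_le D) (prodModS_stable D) h

/-- (PROVED, from (H9)) the same for `P_B` -/
theorem exists_irred_le_prodModSbar (h : prodModSbar D ≠ ⊥) :
    ∃ W : Submodule ℂ HX, W ≤ prodModSbar D ∧ HeckeIrred G W :=
  exists_irred_le_of_stable D (prodModSbar_le D) (prodModSbar_stable D) h

/-- «`P_A` and `P_B` share a Hecke-irreducible constituent»: Hecke-irreducible `W ≤ P_A`, `W' ≤ P_B` and a non-zero
Hecke-equivariant linear map `W → W'` (an abstract isomorphism of constituents; (H10) makes it literal). -/
def CommonIrred : Prop :=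
  ∃ (W W' : Submodule ℂ HX) (hW : HeckeIrred G W) (_hW' : HeckeIrred G W'),
    W ≤ prodModS D ∧ W' ≤ prodModSbar D ∧
    ∃ φ : W →ₗ[ℂ] HX, (∀ x : W, φ x ∈ W') ∧
      (∀ (g : G) (x : W), φ ⟨g • (x : HX), hW.2.1 g x x.2⟩ = g • φ x) ∧ φ ≠ 0

/-- (PROVED, from (H10)) a common abstract constituent is a common subspace: `P_A ⊓ P_B ≠ ⊥` -/
theorem inf_ne_bot_of_common_irred (hc : CommonIrred D) : prodModS D ⊓ prodModSbar D ≠ ⊥ := by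
  obtain ⟨W, W', hW, hW', hWA, hWB, φ, hφ, hφeq, hφne⟩ := hc
  have hEq : W = W' :=
    D.S.H20_multone W W' (hWA.trans (prodModS_le D)) (hWB.trans (prodModSbar_le D)) hW hW' φ hφ hφeq hφne
  intro hbot
  apply hW.1
  rw [← le_bot_iff, ← hbot]
  refine le_inf hWA ?_
  rw [hEq]
  exact hWB

/-- (PROVED) a literal common irreducible subspace gives `CommonIrred` (with `φ` the inclusion) -/
theorem commonIrred_of_irred_le_inf (W : Submodule ℂ HX) (hW : HeckeIrred G W)
    (hA : W ≤ prodModS D) (hB : W ≤ prodModSbar D) : CommonIrred D := by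
  refine ⟨W, W, hW, hW, hA, hB, W.subtype, fun x => x.2, fun g x => rfl, ?_⟩
  intro h0
  obtain ⟨x, hx, hx0⟩ := Submodule.exists_mem_ne_zero_of_ne_bot hW.1
  have := congrArg (fun f : W →ₗ[ℂ] HX => f ⟨x, hx⟩) h0
  simp at this
  exact hx0 this

/-- (PROVED, from (H9)) `P_A ⊓ P_B ≠ ⊥ → CommonIrred`: the stable inf contains an irreducible -/
theorem commonIrred_of_inf_ne_bot (h : prodModS D ⊓ prodModSbar D ≠ ⊥) : CommonIrred D := by
  obtain ⟨W, hWle, hW⟩ := exists_irred_le_of_stable D (inf_le_left.trans (prodModS_le D))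
    (heckeStable_inf (prodModS_stable D) (prodModSbar_stable D)) h
  exact commonIrred_of_irred_le_inf D W hW (hWle.trans inf_le_left) (hWle.trans inf_le_right)

/-- (PROVED) **the crux in its two equivalent forms**: `CommonIrred D ↔ P_A ⊓ P_B ≠ ⊥` — so the line's residual IS
the «common non-zero vector» statement, exactly as crit-1 l. 14626 O2 records -/
theorem commonIrred_iff_inf_ne_bot : CommonIrred D ↔ prodModS D ⊓ prodModSbar D ≠ ⊥ :=
  ⟨inf_ne_bot_of_common_irred D, commonIrred_of_inf_ne_bot D⟩

/-- (PROVED) `CommonIrred → (P)` for the datum -/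
theorem target_of_common_irred (hc : CommonIrred D) :
    ∃ g : Fin 4 → G, D.S.L2 (D.fOmegaS g) (D.fOmegaSbar g) ≠ 0 :=
  exists_pairing_ne_zero_of_inf_ne_bot D (inf_ne_bot_of_common_irred D hc)

/-! ## 5. The closed residual and the DELIVERABLE (crit-2 rider (iv), FROZEN line l. 14604): `p_T7_of_residual` -/

/-- THE RESIDUAL OF LINE 1 as a closed, displayed statement: every period datum has a common Hecke-irreducible
constituent of `P_A` and `P_B` — by `commonIrred_iff_inf_ne_bot` this is «∀ D, P_A ⊓ P_B ≠ ⊥», the common-vector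
form of the target. Two-sided test: it implies `P_T7` through (H4) `hr_pos` + (H10) `H20_multone` (bilinear algebra,
`p_T7_of_residual`); it FAILS in the square-zero datum (`not_commonIrred_of_mul_eq_bot`); whether the CONCLUSION
implies it over the abstract datum is OPEN (it does under finite dimension of `H10 * H10`: t7-L1-p5) — so it is
reported as «≡ C(D) under finite dimension», not as strictly weaker than (P). On the real `X` it is the two-torus
statement on `U(W)` (§6–§7), where the line's L-value-free analysis (LEMMAS.md §2 (a)–(e)) lives. -/
def R_CommonIrred : Prop :=
  ∀ (K : Type) [Field K] [NumberField K] (E' : Type) [Field E'] [NumberField E']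
    (V : Type) [AddCommGroup V] [Module E' V] (HX : Type) [Ring HX] [Algebra ℂ HX]
    (G : Type) [Group G] [MulAction G HX] (D : PeriodDatum K E' V HX G), CommonIrred D

/-- **DELIVERABLE (sorry-free)**: `R_CommonIrred → P_T7`, consuming (H3), (H4), (H10) and the datum. -/
theorem p_T7_of_residual (h : R_CommonIrred) : P_T7 := by
  intro K _ _ E' _ _ V _ _ HX _ _ G _ _ D
  exact target_of_common_irred D (h K E' V HX G D)

/-- (PROVED) the residual FAILS in every datum with `H10 * H10 = ⊥` — in particular in the square-zero
counter-model of record (crit-1, JunkModel-v7): the two-sided test's «R must fail in the junk datum». -/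
theorem not_commonIrred_of_mul_eq_bot (hbot : D.S.H10 * D.S.H10 = ⊥) : ¬ CommonIrred D := by
  rintro ⟨W, W', hW, hW', hWA, hWB, -⟩
  exact hW.1 (le_bot_iff.mp (hWA.trans ((prodModS_le D).trans hbot.le)))

end

end Summit.Ventures.HodgeRepro2.Tier7.Line1
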